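import Literature.AlgebraicGeometry.Limits.SubalgebraDiagram
import Literature.AlgebraicGeometry.Motives.CartierDivisorExtension
import Literature.AlgebraicGeometry.Motives.FunctionFieldOver
import HarnessLib

/-!
# Limits of schemes: descent of rational functions, of units and of coverings along
# `(P ⊗ Spec B).left = lim_t (P ⊗ Spec K[t]).left`

Topic: `Literature/AlgebraicGeometry/Limits` (Görtz–Wedhorn I, (10.13) and Thm. 10.57: for a
filtered limit `S = lim S_λ` of qcqs schemes with affine transition maps,
`Γ(S, 𝒪) = colim Γ(S_λ, 𝒪)`, quasi-compact opens and finite coverings come from a finite stage;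
EGA IV₃ 8.2–8.3). `Limits/SubalgebraDiagram` presents, for a `K`-scheme `P` and a `K`-algebra `B`,
`(P ⊗ Spec B).left` as the limit of the cofiltered diagram `prodDiagram K B s₁ P` of the
`(P ⊗ Spec K[t]).left`, `t ⊇ s₁` finite, `K[t] ⊆ B` the generated subalgebra (`prodCone`,
`isLimitProdCone`). Here `K` is a field, `B` a domain and `P → Spec K` geometrically integral and
quasi-compact, so that the stages are integral and the legs `leg t = π_t` and the transition maps
are dominant (instances below; the limit `(P ⊗ Spec B).left` is assumed integral), and the field
maps `π_t^♯ : K((P ⊗ Spec K[t]).left) → K((P ⊗ Spec B).left)` (`RatFn.functionFieldMap` of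
`Motives/CartierDivisor`) are defined. This file proves the descent statements for **rational
functions** consumed by the noetherian approximation of Cartier divisors
(`Motives/CartierDivisorLimitDescent`):

* `exists_legLE_eq` — a section of `𝒪` over the preimage `π_t⁻¹V` of an affine open `V` of a
  stage comes from a section over `(D f)⁻¹V` at a finer stage (Mathlib
  `exists_appTop_π_eq_of_isAffine_of_isLimit` on the diagram of the `(D f)⁻¹V`,
  `isLimitOpensCone`); `exists_mapLE_eq_zero` — and a stage section vanishing on the limit
  vanishes at a finer stage (Mathlib `exists_app_map_eq_zero_of_isLimit`);
* `exists_functionFieldMap_eq` — **every rational function on the limit is `π_t^♯` of a rational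
  function on some stage**;
* `exists_forall_isUnitAt_functionFieldMap` — **if `π_t^♯ h` is a unit at every point of `π_t⁻¹V`,
  `V ⊆ (P ⊗ Spec K[t]).left` an affine open, then at some finer stage `t'` the pullback of `h` is
  a unit at every point of the preimage of `V`** (the unit `u = π_t^♯ h|_{π_t⁻¹V} ∈ Γ(π_t⁻¹V, 𝒪)^×`,
  its inverse and the relation `u u⁻¹ = 1` descend);
* `exists_map_preimage_iSup_eq_top` — a family of opens of a stage whose preimages cover the
  limit covers some finer stage (Mathlib `exists_map_eq_top`);
* `isDominant_whiskerLeft_left` — `(P ⊗ T').left → (P ⊗ T).left` is dominant for `T' → T`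
  dominant and `P → Spec K` universally open (its image is the preimage of a dense set under the
  open projection), whence dominance of legs and transition maps.

Mathlib searched (pin): `AffineTransitionLimit` (`opensDiagram`, `opensCone`, `isLimitOpensCone`,
`exists_appTop_π_eq_of_isAffine_of_isLimit`, `exists_app_map_eq_zero_of_isLimit`,
`exists_map_eq_top`, `isBasis_preimage_isAffineOpen`), `Scheme.Hom.resLE_app_top`,
`Scheme.Hom.appLE_comp_appLE`, `Scheme.Hom.map_appLE`, `Scheme.Pullback.range_map`,
`Dense.preimage`, `Scheme.Hom.isOpenMap`, `IsCofiltered.cospan` (used). In this tree: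
`RatFn.functionFieldMap`, `ofSection`, `functionFieldMap_ofSection`, `sectionOf`
(`Motives/CartierDivisor`, `Motives/FunctionFieldOver`, `Motives/CartierDivisorExtension`).

## References

* U. Görtz, T. Wedhorn, *Algebraic Geometry I: Schemes*, 2nd ed. (2020), (10.13), Thm. 10.57,
  Prop. 10.62, pp. 321–327. [GortzWedhorn2020]
* A. Grothendieck, EGA IV₃, §8.2 (Thm. 8.2.11) and §8.3 (Publ. Math. IHÉS 28, 1966). [EGAIV3]
-/

noncomputable section

universe u

open CategoryTheory CategoryTheory.Limits AlgebraicGeometry TopologicalSpace MonoidalCategory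
open Opposite

namespace Literature.AlgebraicGeometry.Limits

namespace SubalgApprox

open Literature.AlgebraicGeometry.Motives Literature.AlgebraicGeometry.Motives.RatFn

set_option backward.isDefEq.respectTransparency false

/-! ## Generalities -/

/-- `f.resLE U V e` is `f.appLE U V e` on global sections of the restricted schemes (transported
through `Scheme.Opens.topIso`). [folklore] -/
theorem topIso_inv_resLE_appTop_topIso_hom {X Y : Scheme.{u}} (f : X ⟶ Y) (U : Y.Opens)
    (V : X.Opens) (e : V ≤ f ⁻¹ᵁ U) :
    U.topIso.inv ≫ (f.resLE U V e).appTop ≫ V.topIso.hom = f.appLE U V e := by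
  rw [Scheme.Hom.appTop, Scheme.Hom.resLE_app_top]
  simp only [Category.assoc, Iso.inv_hom_id_assoc, Iso.inv_hom_id, Category.comp_id]

/-- Elementwise form of `topIso_inv_resLE_appTop_topIso_hom`. [folklore] -/
theorem appLE_topIso_hom_apply {X Y : Scheme.{u}} (f : X ⟶ Y) (U : Y.Opens)
    (V : X.Opens) (e : V ≤ f ⁻¹ᵁ U) (r : Γ(U, ⊤)) :
    f.appLE U V e (U.topIso.hom r) = V.topIso.hom ((f.resLE U V e).appTop r) := by
  rw [← topIso_inv_resLE_appTop_topIso_hom f U V e]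
  simp only [CommRingCat.comp_apply]
  erw [Iso.hom_inv_id_apply]

/-- `appLE` along equal morphisms (all casts on the morphism variable, so that no definitional
unfolding of concrete morphisms is needed downstream). [folklore] -/
theorem appLE_congrHom {X Y : Scheme.{u}} {f g : X ⟶ Y} (h : f = g) (U : Y.Opens) (V : X.Opens)
    (e : V ≤ f ⁻¹ᵁ U) (e' : V ≤ g ⁻¹ᵁ U) : f.appLE U V e = g.appLE U V e' := by
  subst h; rfl

/-- `Scheme.Hom.appLE_comp_appLE` with the composite replaced by an equal morphism. [folklore] -/
theorem appLE_comp_appLE_of_comp_eq {X Y Z : Scheme.{u}} (f : X ⟶ Y) (g : Y ⟶ Z) (k : X ⟶ Z)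
    (h : f ≫ g = k) (U : Z.Opens) (V : Y.Opens) (W : X.Opens) (e₁ : V ≤ g ⁻¹ᵁ U)
    (e₂ : W ≤ f ⁻¹ᵁ V) (e₃ : W ≤ k ⁻¹ᵁ U) :
    g.appLE U V e₁ ≫ f.appLE V W e₂ = k.appLE U W e₃ := by
  subst h
  exact Scheme.Hom.appLE_comp_appLE f g U V W e₁ e₂

/-- Restriction of sections between *equal* opens is injective (it is an isomorphism).
[folklore] -/
theorem presheaf_map_injective_of_eq {X : Scheme.{u}} {A A' : X.Opens} (h : A = A')
    (i : op A ⟶ op A') : Function.Injective (X.presheaf.map i) := by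
  subst h
  obtain rfl : i = 𝟙 _ := Subsingleton.elim _ _
  rw [X.presheaf.map_id]
  intro a b hab
  simpa using hab

/-- `functionFieldMap` does not depend on the way the (dominant) morphism is written. [folklore] -/
theorem functionFieldMap_congr {X Y : Scheme.{u}} [IsIntegral X] [IsIntegral Y] {f g : X ⟶ Y}
    [IsDominant f] [IsDominant g] (e : f = g) : functionFieldMap f = functionFieldMap g := by
  subst e; rfl

/-- A unit section defines a rational function which is a unit at every point of the open.
[folklore] -/
theorem isUnitAt_ofSection_of_isUnit {X : Scheme.{u}} [IsIntegral X] {U : X.Opens} {x : X}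
    (hx : x ∈ U) {s : Γ(X, U)} (hs : IsUnit s) :
    IsUnitAt x (ofSection (genericPoint_mem_of_mem hx) s) := by
  rw [isUnitAt_ofSection_iff hx, Scheme.mem_basicOpen _ _ _ hx]
  exact hs.map _

/-! ## Dominance of base changes `(P ⊗ T').left → (P ⊗ T).left` -/

section Whisker

variable {K : Type u} [CommRing K] (P : SchemeOver K) {T T' : SchemeOver K} (g : T' ⟶ T)

/-- **`(P ⊗ T').left → (P ⊗ T).left` is dominant for `T' → T` dominant and `P → Spec K`
universally open**: its image is the preimage of the dense image of `T'.left → T.left` under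
the open projection `(P ⊗ T).left → T.left`. [folklore] -/
instance isDominant_whiskerLeft_left [UniversallyOpen P.hom] [IsDominant g.left] :
    IsDominant (P ◁ g).left := by
  constructor
  have h1 : Set.range (𝟙 P.left : P.left ⟶ P.left) = Set.univ :=
    Set.eq_univ_of_forall fun x => ⟨x, by simp⟩
  have hr : Set.range (P ◁ g).left = (pullback.snd P.hom T.hom) ⁻¹' Set.range g.left := by
    have h := Scheme.Pullback.range_map P.hom T'.hom P.hom T.hom (𝟙 _) g.left (𝟙 _)
      (by rw [Category.comp_id, Category.id_comp]) (by rw [Category.comp_id]; exact (Over.w g).symm)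
    rw [h1, Set.preimage_univ, Set.univ_inter] at h
    exact h
  change Dense (Set.range (P ◁ g).left)
  rw [hr]
  exact (IsDominant.denseRange (f := g.left)).preimage (pullback.snd P.hom T.hom).isOpenMap

end Whisker

/-! ## The legs, integrality and dominance over a field -/

section Field

variable {K : Type u} [Field K] (B : Type u) [CommRing B] [Algebra K B] (s₁ : Finset B)
  (P : SchemeOver K)

/-- The leg `π_t : (P ⊗ Spec B).left → (P ⊗ Spec K[t]).left` of `prodCone` (with its source
written as the cone point). [folklore] -/
abbrev leg (t : (Idx B s₁)ᵒᵖ) : (prodCone K B s₁ P).pt ⟶ (prodDiagram K B s₁ P).obj t :=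
  (prodCone K B s₁ P).π.app t

/-- The legs commute with the transition maps. [folklore] -/
@[reassoc]
theorem leg_map {t t' : (Idx B s₁)ᵒᵖ} (f : t' ⟶ t) :
    leg B s₁ P t' ≫ (prodDiagram K B s₁ P).map f = leg B s₁ P t :=
  (prodCone K B s₁ P).w f

/-- The legs are affine. [folklore] -/
instance isAffineHom_leg (t : (Idx B s₁)ᵒᵖ) : IsAffineHom (leg B s₁ P t) :=
  isAffineHom_prodCone_π_app K B s₁ P t

variable [IsDomain B]

/-- Over a field, for `P` geometrically integral and `B` a domain, the stages
`(P ⊗ Spec K[t]).left` are integral (Görtz–Wedhorn I, Prop. 5.51 (ii); Mathlib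
`GeometricallyIntegral` with a locally noetherian integral second factor). [folklore] -/
instance isIntegral_prodDiagram_obj [GeometricallyIntegral P.hom] (t : (Idx B s₁)ᵒᵖ) :
    IsIntegral ((prodDiagram K B s₁ P).obj t) := by
  change IsIntegral ↑(pullback P.hom ((baseDiagram K B s₁).obj t).hom)
  infer_instance

/-- The legs `(P ⊗ Spec B).left → (P ⊗ Spec K[t]).left` are dominant. [folklore] -/
instance isDominant_leg (t : (Idx B s₁)ᵒᵖ) : IsDominant (leg B s₁ P t) := by
  change IsDominant (P ◁ (baseCone K B s₁).π.app t).left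
  infer_instance

/-- The transition maps `(P ⊗ Spec K[t']).left → (P ⊗ Spec K[t]).left` are dominant. [folklore] -/
instance isDominant_prodDiagram_map {t t' : (Idx B s₁)ᵒᵖ} (f : t ⟶ t') :
    IsDominant ((prodDiagram K B s₁ P).map f) := by
  rw [prodDiagram_map]
  infer_instance

end Field

/-! ## Descent of sections of `𝒪` -/

section Sections

variable {K : Type u} [Field K] {B : Type u} [CommRing B] [Algebra K B] {s₁ : Finset B}
  {P : SchemeOver K}

omit [Field K] [CommRing B] [Algebra K B] in
/-- The index category `(Idx B s₁)ᵒᵖ` is thin. [folklore] -/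
theorem hom_eq {t t' : (Idx B s₁)ᵒᵖ} (f g : t ⟶ t') : f = g :=
  Quiver.Hom.unop_inj (Subsingleton.elim _ _)

/-- The preimage of `(D f)⁻¹V` under `π_{t'}` is `π_t⁻¹V`. [folklore] -/
theorem preimage_map_preimage {t t' : (Idx B s₁)ᵒᵖ} (f : t' ⟶ t)
    (V : ((prodDiagram K B s₁ P).obj t).Opens) :
    leg B s₁ P t' ⁻¹ᵁ ((prodDiagram K B s₁ P).map f ⁻¹ᵁ V) = leg B s₁ P t ⁻¹ᵁ V := by
  rw [← Scheme.Hom.comp_preimage, leg_map]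

/-- The preimage of `(D f)⁻¹V` under `D g` is `(D (g ≫ f))⁻¹V`. [folklore] -/
theorem map_preimage_map_preimage {t t' t'' : (Idx B s₁)ᵒᵖ} (g : t'' ⟶ t') (f : t' ⟶ t)
    (V : ((prodDiagram K B s₁ P).obj t).Opens) :
    (prodDiagram K B s₁ P).map g ⁻¹ᵁ ((prodDiagram K B s₁ P).map f ⁻¹ᵁ V) =
      (prodDiagram K B s₁ P).map (g ≫ f) ⁻¹ᵁ V := by
  rw [← Scheme.Hom.comp_preimage, ← Functor.map_comp]

/-- The comparison maps `Γ((D f)⁻¹V) → Γ(π_t⁻¹V)` along the legs. [folklore] -/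
abbrev legLE {t t' : (Idx B s₁)ᵒᵖ} (f : t' ⟶ t) (V : ((prodDiagram K B s₁ P).obj t).Opens) :
    Γ((prodDiagram K B s₁ P).obj t', (prodDiagram K B s₁ P).map f ⁻¹ᵁ V) ⟶
      Γ((prodCone K B s₁ P).pt, leg B s₁ P t ⁻¹ᵁ V) :=
  (leg B s₁ P t').appLE _ _ (preimage_map_preimage f V).ge

/-- The restriction maps `Γ((D f)⁻¹V) → Γ((D (g ≫ f))⁻¹V)` along the transition maps. [folklore] -/
abbrev mapLE {t t' t'' : (Idx B s₁)ᵒᵖ} (g : t'' ⟶ t') (f : t' ⟶ t)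
    (V : ((prodDiagram K B s₁ P).obj t).Opens) :
    Γ((prodDiagram K B s₁ P).obj t', (prodDiagram K B s₁ P).map f ⁻¹ᵁ V) ⟶
      Γ((prodDiagram K B s₁ P).obj t'', (prodDiagram K B s₁ P).map (g ≫ f) ⁻¹ᵁ V) :=
  ((prodDiagram K B s₁ P).map g).appLE _ _ (map_preimage_map_preimage g f V).ge

/-- Moving a stage section to a finer stage does not change its image on the limit. [folklore] -/
theorem legLE_mapLE {t t' t'' : (Idx B s₁)ᵒᵖ} (g : t'' ⟶ t') (f : t' ⟶ t)
    (V : ((prodDiagram K B s₁ P).obj t).Opens)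
    (s : Γ((prodDiagram K B s₁ P).obj t', (prodDiagram K B s₁ P).map f ⁻¹ᵁ V)) :
    legLE (g ≫ f) V (mapLE g f V s) = legLE f V s := by
  change (mapLE g f V ≫ legLE (g ≫ f) V) s = _
  rw [appLE_comp_appLE_of_comp_eq (leg B s₁ P t'') ((prodDiagram K B s₁ P).map g) (leg B s₁ P t')
    (leg_map B s₁ P g) _ _ _ _ _ (preimage_map_preimage f V).ge]

/-- **Sections over `π_t⁻¹V`, `V` affine, come from a finite stage** (`Γ(lim, 𝒪) = colim Γ`;
Görtz–Wedhorn I, Thm. 10.57 for `Γ(-, 𝒪)`). [cite: GortzWedhorn2020, Thm. 10.57 (p. 325)] -/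
theorem exists_legLE_eq {t : (Idx B s₁)ᵒᵖ} {V : ((prodDiagram K B s₁ P).obj t).Opens}
    (hV : IsAffineOpen V) (s : Γ((prodCone K B s₁ P).pt, leg B s₁ P t ⁻¹ᵁ V)) :
    ∃ (t' : (Idx B s₁)ᵒᵖ) (f : t' ⟶ t)
      (s' : Γ((prodDiagram K B s₁ P).obj t', (prodDiagram K B s₁ P).map f ⁻¹ᵁ V)),
      legLE f V s' = s := by
  have (j : Over t) : IsAffine ((opensDiagram (prodDiagram K B s₁ P) t V).obj j) :=
    hV.preimage _
  obtain ⟨j, r, hr⟩ := exists_appTop_π_eq_of_isAffine_of_isLimit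
    (opensDiagram (prodDiagram K B s₁ P) t V)
    (opensCone (prodDiagram K B s₁ P) (prodCone K B s₁ P) t V)
    (isLimitOpensCone _ _ (isLimitProdCone K B s₁ P) t V)
    ((leg B s₁ P t ⁻¹ᵁ V).topIso.inv s)
  refine ⟨j.left, j.hom, ((prodDiagram K B s₁ P).map j.hom ⁻¹ᵁ V).topIso.hom r, ?_⟩
  have hs : s = (leg B s₁ P t ⁻¹ᵁ V).topIso.hom
      (((opensCone (prodDiagram K B s₁ P) (prodCone K B s₁ P) t V).π.app j).appTop r) :=
    (leg B s₁ P t ⁻¹ᵁ V).topIso.commRingCatIsoToRingEquiv.symm_apply_eq.mp hr.symm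
  rw [hs]
  exact appLE_topIso_hom_apply (leg B s₁ P j.left) _ _ _ r

/-- **A stage section vanishing on the limit vanishes at a finer stage** (injectivity half of
`Γ(lim, 𝒪) = colim Γ`). [cite: GortzWedhorn2020, Thm. 10.57 (p. 325)] -/
theorem exists_mapLE_eq_zero {t t' : (Idx B s₁)ᵒᵖ} (f : t' ⟶ t)
    {V : ((prodDiagram K B s₁ P).obj t).Opens}
    (hV : IsCompact (V : Set ((prodDiagram K B s₁ P).obj t)))
    (s : Γ((prodDiagram K B s₁ P).obj t', (prodDiagram K B s₁ P).map f ⁻¹ᵁ V))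
    (hs : legLE f V s = 0) :
    ∃ (t'' : (Idx B s₁)ᵒᵖ) (g : t'' ⟶ t'), mapLE g f V s = 0 := by
  have hc : IsCompact (((prodDiagram K B s₁ P).map f ⁻¹ᵁ V :
      ((prodDiagram K B s₁ P).obj t').Opens) : Set ((prodDiagram K B s₁ P).obj t')) :=
    ((prodDiagram K B s₁ P).map f).isCompact_preimage hV
  have hs' : (leg B s₁ P t').app ((prodDiagram K B s₁ P).map f ⁻¹ᵁ V) s = 0 := by
    apply presheaf_map_injective_of_eq (preimage_map_preimage f V)
      (homOfLE (preimage_map_preimage f V).ge).op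
    rw [map_zero]
    exact hs
  obtain ⟨t'', g, hg⟩ := exists_app_map_eq_zero_of_isLimit (prodDiagram K B s₁ P)
    (prodCone K B s₁ P) (isLimitProdCone K B s₁ P) hc s hs'
  refine ⟨t'', g, ?_⟩
  change (((prodDiagram K B s₁ P).map g).app ((prodDiagram K B s₁ P).map f ⁻¹ᵁ V) ≫
    ((prodDiagram K B s₁ P).obj t'').presheaf.map (homOfLE (map_preimage_map_preimage g f V).ge).op)
      s = 0
  rw [CommRingCat.comp_apply, hg, map_zero]

end Sections

/-! ## Descent of rational functions and of units -/

section RatFn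

variable {K : Type u} [Field K] {B : Type u} [CommRing B] [IsDomain B] [Algebra K B]
  {s₁ : Finset B} {P : SchemeOver K} [GeometricallyIntegral P.hom]
  [IsIntegral (prodCone K B s₁ P).pt]

/-- If `π_t⁻¹V` contains the generic point of the limit then `V` contains the generic point of
the stage. [folklore] -/
theorem genericPoint_mem_of_mem_preimage {t : (Idx B s₁)ᵒᵖ}
    {V : ((prodDiagram K B s₁ P).obj t).Opens}
    (h : genericPoint (prodCone K B s₁ P).pt ∈ leg B s₁ P t ⁻¹ᵁ V) :
    genericPoint ((prodDiagram K B s₁ P).obj t) ∈ V := by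
  rw [← genericPoint_eq_of_isDominant (leg B s₁ P t)]
  exact h

/-- `ofSection` of the image on the limit of a stage section is `π^♯` of `ofSection` of the stage
section. [folklore] -/
theorem ofSection_legLE {t t' : (Idx B s₁)ᵒᵖ} (f : t' ⟶ t)
    {V : ((prodDiagram K B s₁ P).obj t).Opens}
    (hξ : genericPoint (prodCone K B s₁ P).pt ∈ leg B s₁ P t ⁻¹ᵁ V)
    (s : Γ((prodDiagram K B s₁ P).obj t', (prodDiagram K B s₁ P).map f ⁻¹ᵁ V)) :
    ofSection hξ (legLE f V s) =
      functionFieldMap (leg B s₁ P t')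
        (ofSection (genericPoint_mem_of_mem_preimage (by rwa [preimage_map_preimage])) s) := by
  rw [functionFieldMap_ofSection, legLE, Scheme.Hom.appLE, CommRingCat.comp_apply, ofSection_map]

omit [IsIntegral (prodCone K B s₁ P).pt] in
/-- `ofSection` of a stage section moved to a finer stage is the pullback of `ofSection`.
[folklore] -/
theorem ofSection_mapLE {t t' t'' : (Idx B s₁)ᵒᵖ} (g : t'' ⟶ t') (f : t' ⟶ t)
    {V : ((prodDiagram K B s₁ P).obj t).Opens}
    (hξ : genericPoint ((prodDiagram K B s₁ P).obj t') ∈ (prodDiagram K B s₁ P).map f ⁻¹ᵁ V)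
    (s : Γ((prodDiagram K B s₁ P).obj t', (prodDiagram K B s₁ P).map f ⁻¹ᵁ V)) :
    ofSection (by rw [← map_preimage_map_preimage]; exact genericPoint_mem_preimage _ hξ)
        (mapLE g f V s) =
      functionFieldMap ((prodDiagram K B s₁ P).map g) (ofSection hξ s) := by
  rw [functionFieldMap_ofSection, mapLE, Scheme.Hom.appLE, CommRingCat.comp_apply, ofSection_map]

/-- The field maps of legs and transition maps are compatible: `π_{t'}^♯ ∘ (D f)^♯ = π_t^♯`.
[folklore] -/
theorem functionFieldMap_leg_map {t t' : (Idx B s₁)ᵒᵖ} (f : t' ⟶ t)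
    (h : ((prodDiagram K B s₁ P).obj t).functionField) :
    functionFieldMap (leg B s₁ P t') (functionFieldMap ((prodDiagram K B s₁ P).map f) h) =
      functionFieldMap (leg B s₁ P t) h := by
  rw [← RingHom.comp_apply, ← functionFieldMap_comp ((prodDiagram K B s₁ P).map f) (leg B s₁ P t')]
  exact DFunLike.congr_fun (functionFieldMap_congr (leg_map B s₁ P f)) h

omit [IsIntegral (prodCone K B s₁ P).pt] in
/-- The field maps of the transition maps compose. [folklore] -/
theorem functionFieldMap_map_map {t t' t'' : (Idx B s₁)ᵒᵖ} (g : t'' ⟶ t') (f : t' ⟶ t)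
    (h : ((prodDiagram K B s₁ P).obj t).functionField) :
    functionFieldMap ((prodDiagram K B s₁ P).map g)
        (functionFieldMap ((prodDiagram K B s₁ P).map f) h) =
      functionFieldMap ((prodDiagram K B s₁ P).map (g ≫ f)) h := by
  rw [← RingHom.comp_apply,
    ← functionFieldMap_comp ((prodDiagram K B s₁ P).map f) ((prodDiagram K B s₁ P).map g)]
  exact DFunLike.congr_fun (functionFieldMap_congr ((prodDiagram K B s₁ P).map_comp g f).symm) h

/-- **Every rational function on the limit comes from a finite stage**: for
`h ∈ K((P ⊗ Spec B).left)` and any stage `t₀` there are a finer stage `t → t₀` and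
`h_t ∈ K((P ⊗ Spec K[t]).left)` with `π_t^♯ h_t = h` (`h` is a section of `𝒪` over some open,
which may be shrunk to the preimage of an affine open of a stage, Mathlib
`isBasis_preimage_isAffineOpen`, and sections descend).
[cite: GortzWedhorn2020, (10.13) and Thm. 10.57 (pp. 321–325)] -/
theorem exists_functionFieldMap_eq (t₀ : (Idx B s₁)ᵒᵖ) (h : (prodCone K B s₁ P).pt.functionField) :
    ∃ (t : (Idx B s₁)ᵒᵖ) (_ : t ⟶ t₀) (h' : ((prodDiagram K B s₁ P).obj t).functionField),
      functionFieldMap (leg B s₁ P t) h' = h := by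
  obtain ⟨U, hξU, s, hs⟩ := (prodCone K B s₁ P).pt.presheaf.exists_germ_eq h
  obtain ⟨_, ⟨_, ⟨i, V, hV, rfl⟩, rfl⟩, hξV, hVU⟩ :=
    (isBasis_preimage_isAffineOpen (prodDiagram K B s₁ P) (prodCone K B s₁ P)
      (isLimitProdCone K B s₁ P)).exists_subset_of_mem_open hξU U.isOpen
  have hle : leg B s₁ P i ⁻¹ᵁ V ≤ U := fun x hx => hVU hx
  obtain ⟨t, f, s', hs'⟩ := exists_legLE_eq hV
    ((prodCone K B s₁ P).pt.presheaf.map (homOfLE hle).op s)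
  obtain ⟨t', ⟨g⟩, ⟨g₀⟩⟩ := exists_hom₂ B s₁ t t₀
  refine ⟨t', g₀, functionFieldMap ((prodDiagram K B s₁ P).map g)
    (ofSection (genericPoint_mem_of_mem_preimage (by rwa [preimage_map_preimage])) s'), ?_⟩
  refine Eq.trans ?_ hs
  rw [functionFieldMap_leg_map, ← ofSection_legLE f hξV, hs', ofSection_map]

/-- **Invertibility of a rational function on the preimage of an affine open descends to a
finite stage**: if `π_t^♯ h` is a unit at every point of `π_t⁻¹V` (`V` an affine open of the
stage `t`), then for some `f : t' → t` the rational function `(D f)^♯ h` is a unit at every point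
of `(D f)⁻¹V` (the unit `u = π_t^♯ h|_{π_t⁻¹V} ∈ Γ(π_t⁻¹V, 𝒪)^×`, its inverse and the relation
`u u⁻¹ = 1` descend; Görtz–Wedhorn I, Thm. 10.57 / EGA IV₃ 8.2.11).
[cite: GortzWedhorn2020, Thm. 10.57 (p. 325)] -/
theorem exists_forall_isUnitAt_functionFieldMap {t : (Idx B s₁)ᵒᵖ}
    {V : ((prodDiagram K B s₁ P).obj t).Opens} (hV : IsAffineOpen V)
    (h : ((prodDiagram K B s₁ P).obj t).functionField)
    (hu : ∀ w : (prodCone K B s₁ P).pt, leg B s₁ P t w ∈ V →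
      IsUnitAt w (functionFieldMap (leg B s₁ P t) h)) :
    ∃ (t' : (Idx B s₁)ᵒᵖ) (f : t' ⟶ t), ∀ w : (prodDiagram K B s₁ P).obj t',
      (prodDiagram K B s₁ P).map f w ∈ V →
        IsUnitAt w (functionFieldMap ((prodDiagram K B s₁ P).map f) h) := by
  classical
  -- dispose of the empty case
  rcases (V : Set ((prodDiagram K B s₁ P).obj t)).eq_empty_or_nonempty with hVe | hVne
  · refine ⟨t, 𝟙 t, fun w hw => ?_⟩
    have : (prodDiagram K B s₁ P).map (𝟙 t) w ∈ (V : Set _) := hw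
    rw [hVe] at this
    exact this.elim
  have hξV : genericPoint ((prodDiagram K B s₁ P).obj t) ∈ V :=
    genericPoint_mem_of_mem hVne.some_mem
  have hξ : genericPoint (prodCone K B s₁ P).pt ∈ leg B s₁ P t ⁻¹ᵁ V :=
    genericPoint_mem_preimage (leg B s₁ P t) hξV
  -- the unit `u` and its inverse `v` over `π⁻¹V`
  have hreg : ∀ w ∈ leg B s₁ P t ⁻¹ᵁ V, IsRegularAt w (functionFieldMap (leg B s₁ P t) h) :=
    fun w hw => (hu w hw).isRegularAt
  have hreg' : ∀ w ∈ leg B s₁ P t ⁻¹ᵁ V, IsRegularAt w (functionFieldMap (leg B s₁ P t) h)⁻¹ :=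
    fun w hw => (hu w hw).inv.isRegularAt
  have hh0 : functionFieldMap (leg B s₁ P t) h ≠ 0 := (hu _ hξ).ne_zero
  set u := sectionOf hξ _ hreg with hu_def
  set v := sectionOf hξ _ hreg' with hv_def
  have huv : u * v = 1 := by
    apply germ_injective_of_isIntegral _ (genericPoint _) hξ
    change ofSection hξ (u * v) = ofSection hξ 1
    simp only [map_mul, map_one, hu_def, hv_def, ofSection_sectionOf, mul_inv_cancel₀ hh0]
  -- descend `u`, `v` to a common stage `t₃`
  obtain ⟨t₁, f₁, u₁, hu₁⟩ := exists_legLE_eq hV u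
  obtain ⟨t₂, f₂, v₂, hv₂⟩ := exists_legLE_eq hV v
  obtain ⟨t₃, g₁, g₂, hg⟩ := IsCofiltered.cospan f₁ f₂
  have eV : (prodDiagram K B s₁ P).map (g₁ ≫ f₁) ⁻¹ᵁ V = (prodDiagram K B s₁ P).map (g₂ ≫ f₂) ⁻¹ᵁ V := by
    rw [hg]
  set u₃ := mapLE g₁ f₁ V u₁ with hu₃
  set v₃ := ((prodDiagram K B s₁ P).obj t₃).presheaf.map (eqToHom eV).op (mapLE g₂ f₂ V v₂)
    with hv₃
  have hu₃' : legLE (g₁ ≫ f₁) V u₃ = u := by rw [hu₃, legLE_mapLE, hu₁]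
  have hv₃' : legLE (g₁ ≫ f₁) V v₃ = v := by
    have e := Scheme.Hom.map_appLE (leg B s₁ P t₃) (preimage_map_preimage (g₁ ≫ f₁) V).ge
      (eqToHom eV).op (U := (prodDiagram K B s₁ P).map (g₁ ≫ f₁) ⁻¹ᵁ V)
    change (((prodDiagram K B s₁ P).obj t₃).presheaf.map (eqToHom eV).op ≫ legLE (g₁ ≫ f₁) V)
      (mapLE g₂ f₂ V v₂) = v
    rw [e]
    change legLE (g₂ ≫ f₂) V (mapLE g₂ f₂ V v₂) = v
    rw [legLE_mapLE, hv₂]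
  -- descend the relation `u v = 1` to a stage `t₄`
  have hrel : legLE (g₁ ≫ f₁) V (u₃ * v₃ - 1) = 0 := by
    simp only [map_sub, map_mul, map_one, hu₃', hv₃', huv, sub_self]
  obtain ⟨t₄, g₄, hg₄⟩ := exists_mapLE_eq_zero (g₁ ≫ f₁) hV.isCompact _ hrel
  refine ⟨t₄, g₄ ≫ g₁ ≫ f₁, fun w hw => ?_⟩
  -- `(D g₄)^* u₃` is a unit on `(D (g₄ ≫ g₁ ≫ f₁))⁻¹ V` ...
  have hunit : IsUnit (mapLE g₄ (g₁ ≫ f₁) V u₃) := by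
    simp only [map_sub, map_mul, map_one, sub_eq_zero] at hg₄
    exact IsUnit.of_mul_eq_one _ hg₄
  have hwV : w ∈ (prodDiagram K B s₁ P).map (g₄ ≫ g₁ ≫ f₁) ⁻¹ᵁ V := hw
  have key := isUnitAt_ofSection_of_isUnit hwV hunit
  -- ... and its rational function is `(D (g₄ ≫ g₁ ≫ f₁))^♯ h`
  have hξ₁ : genericPoint ((prodDiagram K B s₁ P).obj t₁) ∈ (prodDiagram K B s₁ P).map f₁ ⁻¹ᵁ V :=
    genericPoint_mem_preimage _ hξV
  have hξ₃ : genericPoint ((prodDiagram K B s₁ P).obj t₃) ∈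
      (prodDiagram K B s₁ P).map (g₁ ≫ f₁) ⁻¹ᵁ V := genericPoint_mem_preimage _ hξV
  have e₁ : ofSection hξ₁ u₁ = functionFieldMap ((prodDiagram K B s₁ P).map f₁) h := by
    apply (functionFieldMap (leg B s₁ P t₁)).injective
    rw [← ofSection_legLE f₁ hξ u₁, hu₁, functionFieldMap_leg_map, hu_def, ofSection_sectionOf]
  have e₃ : ofSection hξ₃ u₃ = functionFieldMap ((prodDiagram K B s₁ P).map (g₁ ≫ f₁)) h := by
    rw [hu₃, ofSection_mapLE g₁ f₁ hξ₁ u₁, e₁, functionFieldMap_map_map]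
  have e₄ : ofSection (genericPoint_mem_of_mem hwV) (mapLE g₄ (g₁ ≫ f₁) V u₃) =
      functionFieldMap ((prodDiagram K B s₁ P).map (g₄ ≫ g₁ ≫ f₁)) h := by
    rw [ofSection_mapLE g₄ (g₁ ≫ f₁) hξ₃ u₃, e₃, functionFieldMap_map_map]
  rwa [e₄] at key

omit [IsDomain B] [GeometricallyIntegral P.hom] [IsIntegral (prodCone K B s₁ P).pt] in
/-- **Preimages of affine opens of the stages form a basis of the limit, refined form**: every
point `x` of an open `U` of `(P ⊗ Spec B).left` lies in `π_t⁻¹V ⊆ U` for an affine open `V` of a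
stage `t` finer than any prescribed stage `t₀` (Mathlib `isBasis_preimage_isAffineOpen`; preimages
of affine opens under the affine transition maps are affine).
[cite: GortzWedhorn2020, (10.13) and Thm. 10.57 (pp. 321–325)] -/
theorem exists_mem_preimage_le (t₀ : (Idx B s₁)ᵒᵖ) {x : (prodCone K B s₁ P).pt}
    {U : (prodCone K B s₁ P).pt.Opens} (hx : x ∈ U) :
    ∃ (t : (Idx B s₁)ᵒᵖ) (_ : t ⟶ t₀) (V : ((prodDiagram K B s₁ P).obj t).Opens),
      IsAffineOpen V ∧ x ∈ leg B s₁ P t ⁻¹ᵁ V ∧ leg B s₁ P t ⁻¹ᵁ V ≤ U := by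
  obtain ⟨_, ⟨_, ⟨i, V, hV, rfl⟩, rfl⟩, hxV, hVU⟩ :=
    (isBasis_preimage_isAffineOpen (prodDiagram K B s₁ P) (prodCone K B s₁ P)
      (isLimitProdCone K B s₁ P)).exists_subset_of_mem_open hx U.isOpen
  obtain ⟨t, ⟨g⟩, ⟨g₀⟩⟩ := exists_hom₂ B s₁ i t₀
  refine ⟨t, g₀, (prodDiagram K B s₁ P).map g ⁻¹ᵁ V, hV.preimage _, ?_, ?_⟩
  · rw [preimage_map_preimage]
    exact hxV
  · rw [preimage_map_preimage]
    exact fun y hy => hVU hy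

/-- **Invertibility on the preimage of a quasi-compact open descends to a finite stage**
(`exists_forall_isUnitAt_functionFieldMap` applied to a finite covering of the quasi-compact
open `V` by affine opens, and a common refinement of the finitely many stages obtained).
[cite: GortzWedhorn2020, Thm. 10.57 (p. 325)] -/
theorem exists_forall_isUnitAt_functionFieldMap_of_isCompact {t : (Idx B s₁)ᵒᵖ}
    {V : ((prodDiagram K B s₁ P).obj t).Opens}
    (hV : IsCompact (V : Set ((prodDiagram K B s₁ P).obj t)))
    (h : ((prodDiagram K B s₁ P).obj t).functionField)
    (hu : ∀ w : (prodCone K B s₁ P).pt, leg B s₁ P t w ∈ V →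
      IsUnitAt w (functionFieldMap (leg B s₁ P t) h)) :
    ∃ (t' : (Idx B s₁)ᵒᵖ) (f : t' ⟶ t), ∀ w : (prodDiagram K B s₁ P).obj t',
      (prodDiagram K B s₁ P).map f w ∈ V →
        IsUnitAt w (functionFieldMap ((prodDiagram K B s₁ P).map f) h) := by
  classical
  -- a finite covering of `V` by affine opens `W k ⊆ V`
  obtain ⟨S, hS, hSf, hSV⟩ :=
    ((prodDiagram K B s₁ P).obj t).isBasis_affineOpens.exists_finite_of_isCompact hV
  haveI : Finite S := hSf
  -- descend on each affine piece
  have hpiece : ∀ W : S, ∃ (t' : (Idx B s₁)ᵒᵖ) (f : t' ⟶ t),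
      ∀ w : (prodDiagram K B s₁ P).obj t',
        (prodDiagram K B s₁ P).map f w ∈ (W : ((prodDiagram K B s₁ P).obj t).Opens) →
        IsUnitAt w (functionFieldMap ((prodDiagram K B s₁ P).map f) h) := fun W => by
    have hWV : (W : ((prodDiagram K B s₁ P).obj t).Opens) ≤ V := fun y hy => by
      rw [hSV]; exact Opens.mem_sSup.2 ⟨W, W.2, hy⟩
    exact exists_forall_isUnitAt_functionFieldMap (hS W.2) h fun w hw => hu w (hWV hw)
  choose tW fW hW using hpiece
  -- a common refinement
  obtain ⟨t', ht'⟩ := exists_hom_of_finite B s₁ (fun W : S => tW W)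
  rcases isEmpty_or_nonempty S with hSe | hSne
  · -- `V = ∅`
    refine ⟨t, 𝟙 t, fun w hw => ?_⟩
    have : (prodDiagram K B s₁ P).map (𝟙 t) w ∈ V := hw
    rw [hSV] at this
    obtain ⟨W, hWS, -⟩ := Opens.mem_sSup.1 this
    exact (hSe.false ⟨W, hWS⟩).elim
  obtain ⟨W₀⟩ := hSne
  refine ⟨t', (ht' W₀).some ≫ fW W₀, fun w hw => ?_⟩
  have hwV : (prodDiagram K B s₁ P).map ((ht' W₀).some ≫ fW W₀) w ∈ V := hw
  rw [hSV] at hwV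
  obtain ⟨W, hWS, hwW⟩ := Opens.mem_sSup.1 hwV
  -- over the piece `W ∋ w` use the stage `tW W`
  have e : (ht' W₀).some ≫ fW W₀ = (ht' ⟨W, hWS⟩).some ≫ fW ⟨W, hWS⟩ := hom_eq _ _
  rw [e] at hwW ⊢
  rw [Functor.map_comp, Scheme.Hom.comp_apply] at hwW
  rw [← functionFieldMap_map_map]
  exact (hW ⟨W, hWS⟩ _ hwW).functionFieldMap

/-! ## Descent of coverings -/

omit [IsDomain B] [GeometricallyIntegral P.hom] [IsIntegral (prodCone K B s₁ P).pt] in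
/-- **A family of opens of a stage whose preimages cover the limit covers a finer stage**
(Görtz–Wedhorn I, (10.13)/Thm. 10.57; Mathlib `exists_map_eq_top`).
[cite: GortzWedhorn2020, Thm. 10.57 (p. 325)] -/
theorem exists_map_preimage_iSup_eq_top [QuasiCompact P.hom] {t : (Idx B s₁)ᵒᵖ} {ι : Type*}
    (V : ι → ((prodDiagram K B s₁ P).obj t).Opens)
    (hV : (⨆ i, leg B s₁ P t ⁻¹ᵁ V i) = ⊤) :
    ∃ (t' : (Idx B s₁)ᵒᵖ) (f : t' ⟶ t), (⨆ i, (prodDiagram K B s₁ P).map f ⁻¹ᵁ V i) = ⊤ := by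
  have h : leg B s₁ P t ⁻¹ᵁ (⨆ i, V i) = ⊤ := by
    rw [Scheme.Hom.preimage_iSup]; exact hV
  obtain ⟨t', f, hf⟩ := exists_map_eq_top (prodDiagram K B s₁ P) (prodCone K B s₁ P)
    (isLimitProdCone K B s₁ P) (⨆ i, V i) h
  exact ⟨t', f, by rw [← Scheme.Hom.preimage_iSup]; exact hf⟩

end RatFn

end SubalgApprox

end Literature.AlgebraicGeometry.Limits

end
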